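/-
Copyright (c) 2026 the pub-hodgecm-mathlib formalisation cell (harness21).  Prover seat hodgecm-mathlib-K2E3-p06 (g0), Track B «K2-LIT» ∕ h413,
ENGINE E3 unit U4 «Keys», SIGS-TABLE row #6 `sig_K2E3IrregularReducibleCaseThree` — helper 3b (the socket ⟸ Keys' Plancherel non-vanishing).  2026-09-04.
-/
import Summits.HodgeConjecture.HodgeConjecture.Theorems.K2E3IrregularReducibleCaseThreeSkewLineSlice   -- ★ helper 3a (this seat): `exists_const_integral_annulus_heisZ_dite_eq_mul_skewLineIntegral`; brings ★ helpers 1–2 and the ★ B3 ∕ B4 ∕ D1 ∕ D2A cone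
import HarnessLib

/-!
# K2 · E3 · U4 «Keys», row #6 `sig_K2E3IrregularReducibleCaseThree` — helper 3b «THE SOCKET ⟸ KEYS' PLANCHEREL NON-VANISHING»: at a non-split `v`, the irregular
# reducibility statement (reducible `w`-fixed `i_G(χ₁, χ₂)` ⟹ `χ₁ ≠ 1 ∧ χ₁|_{F_v^×} = 1`) follows from ONE analytic inequality, the non-vanishing of the skew-line integral
# `J_h(χ₁) = ∫_{E_v⁻} ‖1+η‖⁻¹ χ₁(σ(1+η))⁻¹ dη` for continuous `χ₁` trivial on norms but not on `F_v^×` [Keys1984 §5 (Plancherel measure), §7 Thm. (1); Rogawski1990 §12.2 (3)]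

Cell `pub/hodgecm-mathlib` (D-0151), HCML Track B «K2-LIT», crux H413 = `stmt-HodgeConjecture-24833` (lane `--supports … --as helper`), route
HCCMUnconditional; socket `sig_K2E3IrregularReducibleCaseThree` (U4-c) of `Cruxes/H413/Lines/K2_E3_EllipticInputsSigs_U4Keys.lean` (K2E3-plan (g0), frozen bytes).
THEOREMS ONLY (0 def ∕ 0 instance ∕ 0 notation ∕ 0 sorry); ★-only imports.

THE MATHEMATICS.  With `wχ = χ` (`χ₁(ᾱα) = 1`) and `i_G(χ)` reducible, ★ helper 1 (`r_B = χ · id`) + ★ D1 (split test) + ★ D2A (annulus formula) give, for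
`m = d(α, ᾱα⁻¹, ᾱ⁻¹)` with `Q = ‖α‖ > 1`, the vanishing of the integrals of the cell function `F = f₀(w₀ ·)` over all large annuli `S_A = {A/Q² < ‖u₀₂‖ ≤ A}` (as in
★ helper 2); far out ★ B4 `F(u) = χ₂(−1) · ‖b‖⁻¹ · h(b)`, `b = u₀₂`, `h(b) = χ₁(σ b̂)⁻¹`, so the chart-annulus integral of `‖z‖⁻¹ h(z)` vanishes; by ★ helper 3a it is `K · J_h` with
`K ≠ 0`.  Hence `J_h(χ₁) = 0` — so IF `J_h(χ₁) ≠ 0` whenever `χ₁` is non-trivial on a `σ`-fixed unit (Keys: the Plancherel measure `μ(λ)` vanishes only for `λ|_{F^×} = 1`),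
then `χ₁|_{F_v^×} = 1`; together with ★ helper 2 (`χ₁ ≠ 1`) this is the socket's conclusion.  WHAT REMAINS for row #6 is therefore exactly the analytic letter
«`J_h(χ₁) ≠ 0` for continuous `χ₁` with `χ₁|_{N E_v^×} = 1`, `χ₁|_{F_v^×} ≠ 1`» ([Keys1984, §5]; by ramification type), not claimed here.
* **`apply_fixed_eq_one_of_reducible_irregular_of_skewLineIntegral_ne_zero`** — the second conjunct `∀ a, σ a = a → χ₁ a = 1` from the `J_h` hypothesis;
* **`irregularReducibleCaseThree_of_skewLineIntegral_ne_zero`** — `χ₁ ≠ 1 ∧ ∀ a, σ a = a → χ₁ a = 1` under the socket's exact binders, from the `J_h` hypothesis.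
HONEST LABEL: HC_CM is proved only modulo the 7 printed citations (2 remaining named inputs: hLiu418 = `stmt-HodgeConjecture-24832`, h413 =
`stmt-HodgeConjecture-24833`) until rung 0 closes; this file pays no socket: it RE-LETTERS row #6 to the analytic inequality `J_h(χ₁) ≠ 0` ([Keys1984, §5]), not claimed.

## References
* [Keys1984] D. Keys, *Principal series representations of special unitary groups over local fields*, Compositio Math. 51 (1984), §5 (Plancherel measure); §7 Thm. (1) p. 126.
* [Rogawski1990] J. D. Rogawski, *Automorphic Representations of Unitary Groups in Three Variables*, Ann. of Math. Stud. 123 (1990), §1.10 p. 9; §12.1 p. 171; §12.2 (3) pp. 173–174.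
* [Casselman1995] W. Casselman, *Introduction to the theory of admissible representations of p-adic reductive groups* (1995), §6.3–§6.4, Lemma 7.1.1 (a).
* [BernsteinZelevinsky1977] I. N. Bernstein, A. V. Zelevinsky, Ann. Sci. ÉNS 10 (1977), §2.3, §5 (5.2).
-/

set_option autoImplicit false
-- the mandated namespace has the single-problem summit's repeated segment (`HodgeConjecture.HodgeConjecture`)
set_option linter.dupNamespace false

noncomputable section

open NumberField IsDedekindDomain MeasureTheory Set
open scoped Matrix NNReal ENNReal
open Literature.NumberTheory.Automorphic Literature.NumberTheory.Automorphic.UnitaryGroup Literature.NumberTheory.Automorphic.UnitaryGroup.HeisRing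
open Literature.NumberTheory.GaloisRepresentations Literature.NumberTheory.GaloisRepresentations.IsNonarchimedeanLocalField
open Summit.HodgeConjecture.HodgeConjecture.Cruxes.H413
open Summit.HodgeConjecture.HodgeConjecture.Cruxes.H413.F0P3cStCharTSLocalRingNormDictionary
open Summit.HodgeConjecture.HodgeConjecture.Cruxes.H413.F0P3cStCharTSLocalRingNormCompactness
open Summit.HodgeConjecture.HodgeConjecture.Cruxes.H413.K2E3IrregularReducibleCaseThreeSkewLineSlice

namespace Summit.HodgeConjecture.HodgeConjecture.Cruxes.H413.K2E3IrregularReducibleCaseThreeOfSkewLineIntegral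

variable (L : Type) [Field L] [NumberField L] [IsCMField L] (v : HeightOneSpectrum (𝓞 ↥(maximalRealSubfield L)))
  (hns : ∀ w' : PlacesOver L v, IsCMField.complexConj L • w'.1 = w'.1)

/-! ## The socket's conclusion from `J_h(χ₁) ≠ 0` -/

section Socket

open scoped Classical in
include hns in
set_option synthInstance.maxHeartbeats 400000 in
set_option maxHeartbeats 8000000 in
-- statement∕proof-heavy: the `SmoothInd` carrier of ★ `cmPrincipalSeries` (class of ★ `hSecond_holds` ∕ ★ helper 2 §3); the goal is `False`, so `obtain` is cheap
/-- **SECOND CONJUNCT ⟸ `J_h ≠ 0`.**  At a non-split `v`, for continuous `χ₁, χ₂` with `(χ₁, χ₂) = w(χ₁, χ₂)` and `i_G(χ₁, χ₂)` reducible: IF the skew-line integral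
`J_h(χ₁) = ∫_{R⁻} ‖1+η‖⁻¹ χ₁(σ(1+η))⁻¹ dμ⁻` is non-zero (for the Haar measures of `R⁻`) as soon as `χ₁` is non-trivial on some `σ`-fixed unit, THEN `χ₁|_{F_v^×} = 1`.
Proof: else ★ helper 1 ⟹ ★ D1 ⟹ ★ D2A (annulus integrals of `F = f₀(w₀ ·)` vanish, `m = d(α, ᾱα⁻¹, ᾱ⁻¹)`, `‖α‖ > 1`) ⟹ ★ B4 + §3: `0 = χ₂(−1) · K · J_h` with `K ≠ 0`.
[cite: Keys1984, §5; §7 Thm. (1) p. 126] [cite: Rogawski1990, §12.2 (3) pp. 173–174] [cite: Casselman1995, §6.3–§6.4, Lemma 7.1.1 (a)] -/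
theorem apply_fixed_eq_one_of_reducible_irregular_of_skewLineIntegral_ne_zero
    (χ₁ : (UnitaryGroup.LocalRing L v)ˣ →* ℂˣ) (χ₂ : ↥(normOneUnits (conjLocal L (IsCMField.complexConj L) v)) →* ℂˣ)
    (h₁ : Continuous (fun x => ((χ₁ x : ℂˣ) : ℂ))) (h₂ : Continuous (fun x => ((χ₂ x : ℂˣ) : ℂ)))
    (hirr : UnitaryGroup.cmTorusCharPair L v χ₁ χ₂ = UnitaryGroup.cmTorusCharPair L v (UnitaryGroup.conjInvChar (conjLocal L (IsCMField.complexConj L) v) χ₁) χ₂)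
    (hred : ∃ N : Subrepresentation (UnitaryGroup.cmPrincipalSeries L 3 v (UnitaryGroup.cmTorusCharPair L v χ₁ χ₂)), N ≠ ⊥ ∧ N ≠ ⊤)
    (hJ : (∃ a : (UnitaryGroup.LocalRing L v)ˣ, (conjLocal L (IsCMField.complexConj L) v) (a : UnitaryGroup.LocalRing L v) = a ∧ χ₁ a ≠ 1) →
      ∀ [MeasurableSpace (LocalRing L v)] [BorelSpace (LocalRing L v)]
        (μY : Measure ↥(HeisRing.skewPart (conjLocal L (IsCMField.complexConj L) v))) [μY.IsAddHaarMeasure] [μY.Regular],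
        ∫ η : ↥(HeisRing.skewPart (conjLocal L (IsCMField.complexConj L) v)),
          ((∏ w' : PlacesOver L v, normAbs (w'.1.adicCompletion L) ((1 + (η : LocalRing L v)) w'))⁻¹ : ℝ≥0) •
            (fun b : LocalRing L v => if hb : IsUnit b then
                (((χ₁ (Units.map (conjLocal L (IsCMField.complexConj L) v : LocalRing L v →* LocalRing L v) hb.unit))⁻¹ : ℂˣ) : ℂ) else 0) (1 + (η : LocalRing L v)) ∂μY ≠ 0) :
    ∀ a : (UnitaryGroup.LocalRing L v)ˣ, (conjLocal L (IsCMField.complexConj L) v) (a : UnitaryGroup.LocalRing L v) = a → χ₁ a = 1 := by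
  by_contra hcon
  push Not at hcon
  -- point-set ∕ measure structure (as ★ `hSecond_holds`)
  haveI := locallyCompactSpace_cmBorelU L 3 v
  haveI : LocallyCompactSpace ↥(unitaryGroupOfForm (conjLocal L (IsCMField.complexConj L) v) (cmLocalForm L 3 v)) := locallyCompactSpace_local (IsCMField.complexConj L) 3 _ v
  haveI : SecondCountableTopology (LocalRing L v) := secondCountableTopology_localRing (E := L) v
  letI : MeasurableSpace (LocalRing L v) := borel _
  haveI : BorelSpace (LocalRing L v) := ⟨rfl⟩
  letI : Invertible (2 : LocalRing L v) := (isUnit_two_localRing L v).invertible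
  letI : MeasurableSpace ↥(cmBorelTriple L 3 v).N := borel _
  haveI : BorelSpace ↥(cmBorelTriple L 3 v).N := ⟨rfl⟩
  have hσ := conjLocal_conjLocal_cm L v
  have hσc := continuous_conjLocal L (IsCMField.complexConj L) v
  have hJf := cmLocalForm_eq_over L 3 v
  haveI := HeisRing.locallyCompactSpace_skewPart (conjLocal L (IsCMField.complexConj L) v) hσc
  obtain ⟨w⟩ : Nonempty (PlacesOver L v) := inferInstance
  have hw := hns w
  haveI := isHaarMeasure_heisHaar (conjLocal L (IsCMField.complexConj L) v) hσ hσc hJf (Measure.addHaar : Measure (LocalRing L v))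
    (Measure.addHaar : Measure ↥(HeisRing.skewPart (conjLocal L (IsCMField.complexConj L) v)))
  -- the analytic input, at the Haar measure `addHaar` of `R⁻`
  have hJne := hJ hcon (Measure.addHaar : Measure ↥(HeisRing.skewPart (conjLocal L (IsCMField.complexConj L) v)))
  -- the Weyl element, the standard section `f₀` (`f₀(1) = 1`), `wχ = χ`, `χ₁` trivial on norms
  obtain ⟨w₀, hw₀⟩ := F0P3U3PrincipalSeriesOpenCellTorusChar.exists_weylElt_three L v hns
  obtain ⟨f₀, hf₀, -⟩ := (exists_cmPrincipalSeries_cmTorusCharPair_toFun_one_eq_one L v χ₁ χ₂ h₁ h₂).1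
  have hw' : cmWeylTorusCharPair L v χ₁ χ₂ = cmTorusCharPair L v χ₁ χ₂ := (cmWeylTorusCharPair_eq L v χ₁ χ₂).trans hirr.symm
  have hnorm := (F0P3cStCharTSWeylFixedIffNormTrivial.cmWeylTorusCharPair_eq_iff L v χ₁ χ₂).1 hw'
  -- ★ helper 1: `r_B = χ · id`
  have hscalar := K2E3IrregularReducibleCaseThreeJacquetScalar.normalizedJacquet_eq_smul_of_reducible_irregular L v hns χ₁ χ₂ h₁ h₂ hirr hred
  -- the torus element `m = d(α, ᾱα⁻¹, ᾱ⁻¹)` with `Q = ‖α‖ > 1`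
  obtain ⟨α, hQ⟩ := K2E3IrregularReducibleCaseThreeChiOneNeOne.exists_units_one_lt_distribHaarChar L v hns
  obtain ⟨m, d, hd, hd0⟩ := K2E3IrregularReducibleCaseThreeChiOneNeOne.exists_torus_diag (conjLocal L (IsCMField.complexConj L) v) hσ (cmLocalForm L 3 v) hJf α
  have hQ' : 1 < distribHaarChar (LocalRing L v) (d 0) := by rw [hd0]; exact hQ
  have hQpos : (0 : ℝ) < (distribHaarChar (LocalRing L v) (d 0) : ℝ) := by exact_mod_cast (distribHaarChar_pos : 0 < distribHaarChar (LocalRing L v) (d 0))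
  have hQ2 : (1 : ℝ) ≤ (distribHaarChar (LocalRing L v) (d 0) : ℝ) ^ 2 := one_le_pow₀ (by exact_mod_cast hQ'.le)
  -- ★ D2A (annulus form), ★ B4 (far-out threshold), §3 (chart integral = K · J_h)
  obtain ⟨A₁, hA₁⟩ := F0P3cStCharTSKeys3AnnulusDock.integral_cellFun_sub_eq_neg_smul_setIntegral_annulus L v hns χ₁ χ₂ w₀ hw₀
    (heisHaar (conjLocal L (IsCMField.complexConj L) v) hσ hσc hJf (Measure.addHaar : Measure (LocalRing L v))
      (Measure.addHaar : Measure ↥(HeisRing.skewPart (conjLocal L (IsCMField.complexConj L) v)))) hw' m hd hQ' f₀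
  obtain ⟨A₀, hA₀⟩ := F0P3cStCharTSCellFunFarOut.exists_toFun_weylElt_mul_eq_smul_toFun_one L v hns χ₁ χ₂ w₀ hw₀ f₀
  obtain ⟨K, hK, hKA⟩ := exists_const_integral_annulus_heisZ_dite_eq_mul_skewLineIntegral L v w hw hns χ₁ (Measure.addHaar : Measure (LocalRing L v))
    (Measure.addHaar : Measure ↥(HeisRing.skewPart (conjLocal L (IsCMField.complexConj L) v))) h₁ hnorm (d 0) hQ'
  -- a large `A`: `A ≥ A₁`, `A > 0`, `A / Q² ≥ A₀ + 1`
  obtain ⟨A, hAdef⟩ : ∃ A : ℝ, A = max (max A₁ 1) (((A₀ : ℝ) + 1) * (distribHaarChar (LocalRing L v) (d 0) : ℝ) ^ 2) := ⟨_, rfl⟩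
  have hAA₁ : A₁ ≤ A := by rw [hAdef]; exact le_trans (le_max_left _ _) (le_max_left _ _)
  have hApos : 0 < A := by rw [hAdef]; exact lt_of_lt_of_le one_pos (le_trans (le_max_right _ _) (le_max_left _ _))
  have hAQ : (A₀ : ℝ) + 1 ≤ A / (distribHaarChar (LocalRing L v) (d 0) : ℝ) ^ 2 := by
    rw [le_div_iff₀ (lt_of_lt_of_le one_pos hQ2), hAdef]; exact le_max_right _ _
  -- (i) the annulus integral of `F = f₀(w₀ ·)` over `S_A` vanishes (★ helper 1 ⟹ ★ D1 ⟹ ★ D2A; `χ(m) ≠ 0`)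
  have h0 := hA₁ A hAA₁
  rw [(F0P3cStCharTSKeys3SplitTestDatum.pair_normalizedJacquet_mk_eq_smul_iff_integral_cellFun_eq_zero L v hns χ₁ χ₂ h₁ h₂ w₀ hw₀ _ m f₀).1
    (hscalar m _)] at h0
  have h0' := (smul_eq_zero.1 (neg_eq_zero.1 h0.symm)).resolve_left (Units.ne_zero _)
  -- (ii) far out `F(u) = (χ₂(−1) f₀(1)) • (‖b‖⁻¹ • h b)`, `b = u₀₂` (★ B4, as in ★ «ANNULUS VANISHING»)
  have hz : Continuous fun u : ↥(cmBorelTriple L 3 v).N =>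
      (((u : ↥(unitaryGroupOfForm (conjLocal L (IsCMField.complexConj L) v) (cmLocalForm L 3 v))) : GL (Fin 3) (LocalRing L v)) :
        Matrix (Fin 3) (Fin 3) (LocalRing L v)) 0 2 :=
    (Units.continuous_val.comp (continuous_subtype_val.comp continuous_subtype_val)).matrix_elem 0 2
  have hfar : ∀ u : ↥(cmBorelTriple L 3 v).N, (A₀ : ℝ) + 1 ≤ ((∏ w' : PlacesOver L v, normAbs (w'.1.adicCompletion L)
      ((((u : ↥(unitaryGroupOfForm (conjLocal L (IsCMField.complexConj L) v) (cmLocalForm L 3 v))) : GL (Fin 3) (LocalRing L v)) :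
        Matrix (Fin 3) (Fin 3) (LocalRing L v)) 0 2 w') : ℝ≥0) : ℝ) →
      f₀.toFun ((w₀ : ↥(unitaryGroupOfForm (conjLocal L (IsCMField.complexConj L) v) (cmLocalForm L 3 v))) * u) =
        (((χ₂ ⟨-1, F0P3cStCharTSBigCellFactorisation.neg_one_mem_normOneUnits (conjLocal L (IsCMField.complexConj L) v)⟩ : ℂˣ) : ℂ) * f₀.toFun 1) •
          (fun b : LocalRing L v => ((∏ w' : PlacesOver L v, normAbs (w'.1.adicCompletion L) (b w'))⁻¹ : ℝ≥0) •
            (fun b : LocalRing L v => if hb : IsUnit b then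
                (((χ₁ (Units.map (conjLocal L (IsCMField.complexConj L) v : LocalRing L v →* LocalRing L v) hb.unit))⁻¹ : ℂˣ) : ℂ) else 0) b)
          ((((u : ↥(unitaryGroupOfForm (conjLocal L (IsCMField.complexConj L) v) (cmLocalForm L 3 v))) : GL (Fin 3) (LocalRing L v)) :
            Matrix (Fin 3) (Fin 3) (LocalRing L v)) 0 2) := by
    intro u hu
    have hpos : (0 : ℝ) < ((∏ w' : PlacesOver L v, normAbs (w'.1.adicCompletion L)
        ((((u : ↥(unitaryGroupOfForm (conjLocal L (IsCMField.complexConj L) v) (cmLocalForm L 3 v))) : GL (Fin 3) (LocalRing L v)) :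
          Matrix (Fin 3) (Fin 3) (LocalRing L v)) 0 2 w') : ℝ≥0) : ℝ) := by
      have := A₀.coe_nonneg; linarith
    have hne0 : (((u : ↥(unitaryGroupOfForm (conjLocal L (IsCMField.complexConj L) v) (cmLocalForm L 3 v))) : GL (Fin 3) (LocalRing L v)) :
        Matrix (Fin 3) (Fin 3) (LocalRing L v)) 0 2 ≠ 0 := by
      intro h0e
      rw [h0e, (prod_normAbs_eq_zero_iff L v w hw 0).2 rfl, NNReal.coe_zero] at hpos
      exact lt_irrefl _ hpos
    have hb := (isUnit_iff_ne_zero_localRing L v w hw _).2 hne0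
    have hmod : unitModulusChar (LocalRing L v) hb.unit = ∏ w' : PlacesOver L v, normAbs (w'.1.adicCompletion L)
        ((((u : ↥(unitaryGroupOfForm (conjLocal L (IsCMField.complexConj L) v) (cmLocalForm L 3 v))) : GL (Fin 3) (LocalRing L v)) :
          Matrix (Fin 3) (Fin 3) (LocalRing L v)) 0 2 w') := by
      rw [unitModulusChar_localRing_eq_prod, hb.unit_spec]
    have hle : A₀ ≤ unitModulusChar (LocalRing L v) hb.unit := by
      rw [← NNReal.coe_le_coe, hmod]; linarith
    rw [hA₀ u hb hle]
    beta_reduce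
    rw [dif_pos hb, smul_eq_mul, NNReal.smul_def, Complex.real_smul, hmod, NNReal.coe_inv]
    push_cast
    ring
  -- (iii) the vanishing annulus integral is `(χ₂(−1) f₀(1)) • (K · J_h)`
  have hset : (fun u : ↥(cmBorelTriple L 3 v).N => ((∏ w' : PlacesOver L v, normAbs (w'.1.adicCompletion L)
      ((((u : ↥(unitaryGroupOfForm (conjLocal L (IsCMField.complexConj L) v) (cmLocalForm L 3 v))) : GL (Fin 3) (LocalRing L v)) :
        Matrix (Fin 3) (Fin 3) (LocalRing L v)) 0 2 w') : ℝ≥0) : ℝ)) ⁻¹' Set.Ioc (A / (distribHaarChar (LocalRing L v) (d 0) : ℝ) ^ 2) A =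
      (fun u : ↥(cmBorelTriple L 3 v).N => (((u : ↥(unitaryGroupOfForm (conjLocal L (IsCMField.complexConj L) v) (cmLocalForm L 3 v))) :
        GL (Fin 3) (LocalRing L v)) : Matrix (Fin 3) (Fin 3) (LocalRing L v)) 0 2) ⁻¹'
        ((fun b : LocalRing L v => ((∏ w' : PlacesOver L v, normAbs (w'.1.adicCompletion L) (b w') : ℝ≥0) : ℝ)) ⁻¹'
          Set.Ioc (A / (distribHaarChar (LocalRing L v) (d 0) : ℝ) ^ 2) A) := rfl
  rw [hset, F0P3cStCharTSKeys3TorusConjBall.setIntegral_preimage_eq_integral_indicator_comp _ _ hz.measurable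
    ((measurable_prod_normAbs L v).coe_nnreal_real measurableSet_Ioc)
    (fun b : LocalRing L v =>
      (((χ₂ ⟨-1, F0P3cStCharTSBigCellFactorisation.neg_one_mem_normOneUnits (conjLocal L (IsCMField.complexConj L) v)⟩ : ℂˣ) : ℂ) * f₀.toFun 1) •
        (fun b : LocalRing L v => ((∏ w' : PlacesOver L v, normAbs (w'.1.adicCompletion L) (b w'))⁻¹ : ℝ≥0) •
          (fun b : LocalRing L v => if hb : IsUnit b then
                (((χ₁ (Units.map (conjLocal L (IsCMField.complexConj L) v : LocalRing L v →* LocalRing L v) hb.unit))⁻¹ : ℂˣ) : ℂ) else 0) b) b)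
    (fun u hu => hfar u (le_trans hAQ (le_of_lt hu.1))), F0P3cStCharTSKeys3TorusConjBall.integral_indicator_const_smul_comp,
    F0P3cStCharTSHeisenbergAnnulusSlice.integral_heisHaar_comp_entry (conjLocal L (IsCMField.complexConj L) v) hσ hσc hJf
      (Measure.addHaar : Measure (LocalRing L v)) (Measure.addHaar : Measure ↥(HeisRing.skewPart (conjLocal L (IsCMField.complexConj L) v))) (Set.indicator _ _),
    hKA A hApos] at h0'
  -- (iv) `χ₂(−1) f₀(1) ≠ 0`, `K ≠ 0` ⟹ `J_h = 0`: contradiction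
  have hc : (((χ₂ ⟨-1, F0P3cStCharTSBigCellFactorisation.neg_one_mem_normOneUnits (conjLocal L (IsCMField.complexConj L) v)⟩ : ℂˣ) : ℂ) * f₀.toFun 1) ≠ 0 := by
    rw [hf₀, mul_one]; exact Units.ne_zero _
  exact hJne (((mul_eq_zero.1 ((smul_eq_zero.1 h0').resolve_left hc)).resolve_left hK))

open scoped Classical in
include hns in
set_option synthInstance.maxHeartbeats 400000 in
set_option maxHeartbeats 8000000 in
-- statement-heavy (as above)
/-- **«THE SOCKET ⟸ KEYS' PLANCHEREL NON-VANISHING».**  At a non-split `v`: the conclusion `χ₁ ≠ 1 ∧ χ₁|_{F_v^×} = 1` of `sig_K2E3IrregularReducibleCaseThree` holds under its exact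
binders (continuous `χ₁, χ₂`, `(χ₁, χ₂) = w(χ₁, χ₂)`, `i_G(χ₁, χ₂)` with a `G`-stable `⊥ ≠ N ≠ ⊤`) PROVIDED the skew-line integral `J_h(χ₁) = ∫_{R⁻} ‖1+η‖⁻¹ χ₁(σ(1+η))⁻¹ dμ⁻` does not
vanish whenever `χ₁` is non-trivial on some `σ`-fixed unit — the tree's letter for Keys' «the Plancherel measure `μ(λ)` vanishes only for `λ|_{F^×} = 1`» [Keys1984 §5, §7 Thm. (1)]:
first conjunct ★ helper 2 (unconditional), second conjunct `apply_fixed_eq_one_of_reducible_irregular_of_skewLineIntegral_ne_zero`.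
[cite: Keys1984, §5; §7 Thm. (1) p. 126] [cite: Rogawski1990, §12.2 (3) pp. 173–174] -/
theorem irregularReducibleCaseThree_of_skewLineIntegral_ne_zero
    (χ₁ : (UnitaryGroup.LocalRing L v)ˣ →* ℂˣ) (χ₂ : ↥(normOneUnits (conjLocal L (IsCMField.complexConj L) v)) →* ℂˣ)
    (h₁ : Continuous (fun x => ((χ₁ x : ℂˣ) : ℂ))) (h₂ : Continuous (fun x => ((χ₂ x : ℂˣ) : ℂ)))
    (hirr : UnitaryGroup.cmTorusCharPair L v χ₁ χ₂ = UnitaryGroup.cmTorusCharPair L v (UnitaryGroup.conjInvChar (conjLocal L (IsCMField.complexConj L) v) χ₁) χ₂)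
    (hred : ∃ N : Subrepresentation (UnitaryGroup.cmPrincipalSeries L 3 v (UnitaryGroup.cmTorusCharPair L v χ₁ χ₂)), N ≠ ⊥ ∧ N ≠ ⊤)
    (hJ : (∃ a : (UnitaryGroup.LocalRing L v)ˣ, (conjLocal L (IsCMField.complexConj L) v) (a : UnitaryGroup.LocalRing L v) = a ∧ χ₁ a ≠ 1) →
      ∀ [MeasurableSpace (LocalRing L v)] [BorelSpace (LocalRing L v)]
        (μY : Measure ↥(HeisRing.skewPart (conjLocal L (IsCMField.complexConj L) v))) [μY.IsAddHaarMeasure] [μY.Regular],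
        ∫ η : ↥(HeisRing.skewPart (conjLocal L (IsCMField.complexConj L) v)),
          ((∏ w' : PlacesOver L v, normAbs (w'.1.adicCompletion L) ((1 + (η : LocalRing L v)) w'))⁻¹ : ℝ≥0) •
            (fun b : LocalRing L v => if hb : IsUnit b then
                (((χ₁ (Units.map (conjLocal L (IsCMField.complexConj L) v : LocalRing L v →* LocalRing L v) hb.unit))⁻¹ : ℂˣ) : ℂ) else 0) (1 + (η : LocalRing L v)) ∂μY ≠ 0) :
    χ₁ ≠ 1 ∧ ∀ a : (UnitaryGroup.LocalRing L v)ˣ, (conjLocal L (IsCMField.complexConj L) v) (a : UnitaryGroup.LocalRing L v) = a → χ₁ a = 1 :=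
  ⟨K2E3IrregularReducibleCaseThreeChiOneNeOne.chiOne_ne_one_of_reducible_irregular L v hns χ₁ χ₂ h₁ h₂ hirr hred,
    apply_fixed_eq_one_of_reducible_irregular_of_skewLineIntegral_ne_zero L v hns χ₁ χ₂ h₁ h₂ hirr hred hJ⟩

end Socket

end Summit.HodgeConjecture.HodgeConjecture.Cruxes.H413.K2E3IrregularReducibleCaseThreeOfSkewLineIntegral

end
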